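import Summits.AtomisticToContinuum.HydrodynamicLimit.Theorems.CollisionIsometryCLTAdaptedWeightCLTBHEntropyBudgetWeights

/-!
# Entropy budget (stub `stub_entropyBudget`, line `block-h-dissipation-closure`, crux `AdaptedWeightCLT`,
stmt-AtomisticToContinuum-14868; `--supports`) — helper 5: the cell objects along a free flight
(pointwise chain rule)

Along `r ↦ freeFlight r w` the weights `cw_i(r)` are smooth with derivatives `β_i = Torus.fderiv ψ_N
(x_i − x) v_i` at `r = 0` (helper 4). In a NON-EMPTY cell (`cW ≠ 0`) the one-variable chain rule then
differentiates, at `r = 0` (and hence, by the shift lemma, everywhere the cell stays non-empty):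
* the cell velocity, `cW ∂_r ū = −(Σβ) ū + Σ β_i v_i`, and the cell temperature,
  `cW ∂_r θ̄ = −(Σβ) θ̄ + Σ β_i |v_i − ū|²/3` (the cross term `Σ cw_i ⟪v_i − ū, ∂_r ū⟫` vanishes);
* the KDE, `cW ∂_r f̃(v) = −(Σβ) f̃(v) + Σ β_i G_h(v − v_i)`; the co-moving floor `M_{θ̄+h²,ū}(v)` (helper 1,
  derivative of the Maxwellian along a curve); the regularised law `f̂`, and `f̂ log f̂` with derivative
  `(1 + log f̂) ∂_r f̂`.
All derivatives are written `cW⁻¹ ·` an expression that is POLYNOMIAL in the weights and their derivatives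
(no inverse weights), which vanishes identically on an empty cell.
-/

namespace Summit.AtomisticToContinuum.HydrodynamicLimit.Theorems.BlockHDissipation

open scoped BigOperators Topology Classical MeasureTheory ENNReal InnerProductSpace
open Filter Set MeasureTheory
open Literature.Analysis.FluidPDE
open Literature.Analysis.FunctionSpaces (Torus.IsSmooth)
open Summit.AtomisticToContinuum.HydrodynamicLimit.Theorems.ContactSourceDuhamel (T3 V3 Cfg Vel Flow Flows)
open Literature.MathematicalPhysics.KineticTheory (localMaxwellian_pos localMaxwellian_nonneg continuous_localMaxwellian)

noncomputable section

namespace EntropyBudget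

variable {N : ℕ} {ψ : ℕ → T3 → ℝ} {h δ : ℝ} (w : Cfg N) (x : T3)


/-! ## Cell velocity and cell temperature -/

/-- Velocities do not change in free flight. -/
theorem vel_freeFlight (s : ℝ) (i : Fin (N + 1)) : ((freeFlight (Torus.geometry (Fin 3)) s w) i).2 = (w i).2 := rfl

/-- The inverse total weight along the flight. -/
theorem hasDerivAt_cW_inv (hψs : Torus.IsSmooth (ψ N)) (hS : cW N ψ w x ≠ 0) :
    HasDerivAt (fun s => (cW N ψ (freeFlight (Torus.geometry (Fin 3)) s w) x)⁻¹)
      (-(∑ i, Literature.Analysis.FunctionSpaces.Torus.fderiv (ψ N) ((w i).1 - x) (w i).2) / cW N ψ w x ^ 2) 0 := by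
  have hd := (hasDerivAt_cW w x hψs).fun_inv (by simpa using hS)
  simpa using hd

/-- CELL VELOCITY: `∂_r ū = cW⁻¹ (−(Σβ) ū + Σ β_i v_i)` at `r = 0` in a non-empty cell. -/
theorem hasDerivAt_cU (hψs : Torus.IsSmooth (ψ N)) (hψ : ∀ y, 0 ≤ ψ N y) (hS : cW N ψ w x ≠ 0) :
    HasDerivAt (fun s => cU N ψ (freeFlight (Torus.geometry (Fin 3)) s w) x)
      ((cW N ψ w x)⁻¹ • (-(∑ i, Literature.Analysis.FunctionSpaces.Torus.fderiv (ψ N) ((w i).1 - x) (w i).2) • cU N ψ w x +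
        ∑ i, Literature.Analysis.FunctionSpaces.Torus.fderiv (ψ N) ((w i).1 - x) (w i).2 • (w i).2)) 0 := by
  have hsum : HasDerivAt (fun s => ∑ i, cw N ψ (freeFlight (Torus.geometry (Fin 3)) s w) x i • (w i).2)
      (∑ i, Literature.Analysis.FunctionSpaces.Torus.fderiv (ψ N) ((w i).1 - x) (w i).2 • (w i).2) 0 :=
    HasDerivAt.fun_sum fun i _ => (hasDerivAt_cw w x hψs i).smul_const _
  have hd := (hasDerivAt_cW_inv w x hψs hS).fun_smul hsum
  have e : (fun s => cU N ψ (freeFlight (Torus.geometry (Fin 3)) s w) x) = fun s => (cW N ψ (freeFlight (Torus.geometry (Fin 3)) s w) x)⁻¹ • ∑ i, cw N ψ (freeFlight (Torus.geometry (Fin 3)) s w) x i • (w i).2 := by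
    funext s; rfl
  rw [e]
  refine hd.congr_deriv ?_
  simp only [freeFlight_zero]
  rw [sum_cw_smul_vel w x hψ, smul_smul,
    show -(∑ i, Literature.Analysis.FunctionSpaces.Torus.fderiv (ψ N) ((w i).1 - x) (w i).2) / cW N ψ w x ^ 2 * cW N ψ w x =
      (cW N ψ w x)⁻¹ * -(∑ i, Literature.Analysis.FunctionSpaces.Torus.fderiv (ψ N) ((w i).1 - x) (w i).2) by field_simp,
    ← smul_smul, smul_add]
  abel

/-- The squared distances `|v_i − ū(r)|²` along the flight. -/
theorem hasDerivAt_norm_vel_sub_cU_sq (hψs : Torus.IsSmooth (ψ N)) (hψ : ∀ y, 0 ≤ ψ N y) (hS : cW N ψ w x ≠ 0)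
    (i : Fin (N + 1)) :
    HasDerivAt (fun s => ‖(w i).2 - cU N ψ (freeFlight (Torus.geometry (Fin 3)) s w) x‖ ^ 2)
      (2 * ⟪(w i).2 - cU N ψ w x, -((cW N ψ w x)⁻¹ • (-(∑ j, Literature.Analysis.FunctionSpaces.Torus.fderiv (ψ N) ((w j).1 - x) (w j).2) • cU N ψ w x +
        ∑ j, Literature.Analysis.FunctionSpaces.Torus.fderiv (ψ N) ((w j).1 - x) (w j).2 • (w j).2))⟫_ℝ) 0 := by
  have hd := ((hasDerivAt_const (0 : ℝ) ((w i).2)).fun_sub (hasDerivAt_cU w x hψs hψ hS)).norm_sq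
  simp only [freeFlight_zero, zero_sub] at hd
  exact hd

/-- The cross term vanishes: `Σ_i cw_i ⟪v_i − ū, e⟫ = 0`. -/
theorem sum_cw_inner_vel_sub_cU (hψ : ∀ y, 0 ≤ ψ N y) (e : V3) :
    ∑ i, cw N ψ w x i * ⟪(w i).2 - cU N ψ w x, e⟫_ℝ = 0 := by
  have h1 : ∑ i, cw N ψ w x i • ((w i).2 - cU N ψ w x) = 0 := by
    simp only [smul_sub, Finset.sum_sub_distrib, sum_cw_smul_vel w x hψ, ← Finset.sum_smul]
    exact sub_self _
  have h2 : ∑ i, cw N ψ w x i * ⟪(w i).2 - cU N ψ w x, e⟫_ℝ = ⟪∑ i, cw N ψ w x i • ((w i).2 - cU N ψ w x), e⟫_ℝ := by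
    rw [sum_inner]
    exact Finset.sum_congr rfl fun i _ => by rw [real_inner_smul_left]
  rw [h2, h1, inner_zero_left]

/-- CELL TEMPERATURE: `∂_r θ̄ = cW⁻¹ (−(Σβ) θ̄ + Σ β_i |v_i − ū|²/3)` at `r = 0` in a non-empty cell. -/
theorem hasDerivAt_cT (hψs : Torus.IsSmooth (ψ N)) (hψ : ∀ y, 0 ≤ ψ N y) (hS : cW N ψ w x ≠ 0) :
    HasDerivAt (fun s => cT N ψ (freeFlight (Torus.geometry (Fin 3)) s w) x)
      ((cW N ψ w x)⁻¹ * (-(∑ i, Literature.Analysis.FunctionSpaces.Torus.fderiv (ψ N) ((w i).1 - x) (w i).2) * cT N ψ w x +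
        ∑ i, Literature.Analysis.FunctionSpaces.Torus.fderiv (ψ N) ((w i).1 - x) (w i).2 * (‖(w i).2 - cU N ψ w x‖ ^ 2 / 3))) 0 := by
  set dU : V3 := (cW N ψ w x)⁻¹ • (-(∑ j, Literature.Analysis.FunctionSpaces.Torus.fderiv (ψ N) ((w j).1 - x) (w j).2) • cU N ψ w x +
    ∑ j, Literature.Analysis.FunctionSpaces.Torus.fderiv (ψ N) ((w j).1 - x) (w j).2 • (w j).2) with hdU
  have hterm : ∀ i, HasDerivAt (fun s => cw N ψ (freeFlight (Torus.geometry (Fin 3)) s w) x i * (‖(w i).2 - cU N ψ (freeFlight (Torus.geometry (Fin 3)) s w) x‖ ^ 2 / 3))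
      (Literature.Analysis.FunctionSpaces.Torus.fderiv (ψ N) ((w i).1 - x) (w i).2 * (‖(w i).2 - cU N ψ w x‖ ^ 2 / 3) +
        cw N ψ w x i * (2 * ⟪(w i).2 - cU N ψ w x, -dU⟫_ℝ / 3)) 0 := by
    intro i
    have hd := (hasDerivAt_cw w x hψs i).fun_mul ((hasDerivAt_norm_vel_sub_cU_sq w x hψs hψ hS i).div_const 3)
    simp only [freeFlight_zero] at hd
    exact hd
  have hsum := HasDerivAt.fun_sum fun i (_ : i ∈ Finset.univ) => hterm i
  have hd := (hasDerivAt_cW_inv w x hψs hS).fun_mul hsum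
  have e : (fun s => cT N ψ (freeFlight (Torus.geometry (Fin 3)) s w) x) =
      fun s => (cW N ψ (freeFlight (Torus.geometry (Fin 3)) s w) x)⁻¹ * ∑ i, cw N ψ (freeFlight (Torus.geometry (Fin 3)) s w) x i * (‖(w i).2 - cU N ψ (freeFlight (Torus.geometry (Fin 3)) s w) x‖ ^ 2 / 3) := by
    funext s; rfl
  rw [e]
  refine hd.congr_deriv ?_
  simp only [freeFlight_zero]
  -- the cross term vanishes and `Σ cw_i |v_i − ū|²/3 = cW θ̄`
  have hcross : ∑ i, cw N ψ w x i * (2 * ⟪(w i).2 - cU N ψ w x, -dU⟫_ℝ / 3) = 0 := by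
    have := sum_cw_inner_vel_sub_cU w x hψ (-dU)
    calc ∑ i, cw N ψ w x i * (2 * ⟪(w i).2 - cU N ψ w x, -dU⟫_ℝ / 3)
        = 2 / 3 * ∑ i, cw N ψ w x i * ⟪(w i).2 - cU N ψ w x, -dU⟫_ℝ := by
          rw [Finset.mul_sum]; exact Finset.sum_congr rfl fun i _ => by ring
      _ = 0 := by rw [this, mul_zero]
  have hmom : ∑ i, cw N ψ w x i * (‖(w i).2 - cU N ψ w x‖ ^ 2 / 3) = cW N ψ w x * cT N ψ w x := by
    unfold cT; rw [← mul_assoc, mul_inv_cancel₀ hS, one_mul]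
  rw [Finset.sum_add_distrib, hcross, add_zero, hmom]
  field_simp

/-! ## The KDE, the floor and the regularised law at a fixed velocity -/

/-- KDE: `∂_r f̃(v) = cW⁻¹ (−(Σβ) f̃(v) + Σ β_i G_h(v − v_i))` at `r = 0` in a non-empty cell. -/
theorem hasDerivAt_kde (hψs : Torus.IsSmooth (ψ N)) (hS : cW N ψ w x ≠ 0) (v : V3) :
    HasDerivAt (fun s => kde N ψ h (freeFlight (Torus.geometry (Fin 3)) s w) x v)
      ((cW N ψ w x)⁻¹ * (-(∑ i, Literature.Analysis.FunctionSpaces.Torus.fderiv (ψ N) ((w i).1 - x) (w i).2) * kde N ψ h w x v +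
        ∑ i, Literature.Analysis.FunctionSpaces.Torus.fderiv (ψ N) ((w i).1 - x) (w i).2 * gauss h (w i).2 v)) 0 := by
  have hsum : HasDerivAt (fun s => ∑ i, cw N ψ (freeFlight (Torus.geometry (Fin 3)) s w) x i * gauss h (w i).2 v)
      (∑ i, Literature.Analysis.FunctionSpaces.Torus.fderiv (ψ N) ((w i).1 - x) (w i).2 * gauss h (w i).2 v) 0 :=
    HasDerivAt.fun_sum fun i _ => (hasDerivAt_cw w x hψs i).mul_const _
  have hd := (hasDerivAt_cW_inv w x hψs hS).fun_mul hsum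
  have e : (fun s => kde N ψ h (freeFlight (Torus.geometry (Fin 3)) s w) x v) = fun s => (cW N ψ (freeFlight (Torus.geometry (Fin 3)) s w) x)⁻¹ * ∑ i, cw N ψ (freeFlight (Torus.geometry (Fin 3)) s w) x i * gauss h (w i).2 v := by
    funext s; rfl
  rw [e]
  refine hd.congr_deriv ?_
  simp only [freeFlight_zero]
  have hk : ∑ i, cw N ψ w x i * gauss h (w i).2 v = cW N ψ w x * kde N ψ h w x v := by
    unfold kde; rw [← mul_assoc, mul_inv_cancel₀ hS, one_mul]
  rw [hk]
  field_simp

/-- FLOOR: the co-moving Maxwellian `M_{θ̄+h²,ū}(v)` along the flight, at `r = 0` in a non-empty cell: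
`cW⁻¹ · M · (dT (|v−ū|²/(2θ²) − 3/(2θ)) + ⟪v − ū, dU⟫/θ)`, `θ = θ̄ + h²`. -/
theorem hasDerivAt_floor (hψs : Torus.IsSmooth (ψ N)) (hψ : ∀ y, 0 ≤ ψ N y) (hh : 0 < h) (hS : cW N ψ w x ≠ 0)
    (v : V3) :
    HasDerivAt (fun s => localMaxwellian 1 (cT N ψ (freeFlight (Torus.geometry (Fin 3)) s w) x + h ^ 2) (cU N ψ (freeFlight (Torus.geometry (Fin 3)) s w) x) v)
      ((cW N ψ w x)⁻¹ * (localMaxwellian 1 (cT N ψ w x + h ^ 2) (cU N ψ w x) v *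
        ((-(∑ i, Literature.Analysis.FunctionSpaces.Torus.fderiv (ψ N) ((w i).1 - x) (w i).2) * cT N ψ w x +
            ∑ i, Literature.Analysis.FunctionSpaces.Torus.fderiv (ψ N) ((w i).1 - x) (w i).2 * (‖(w i).2 - cU N ψ w x‖ ^ 2 / 3)) *
          (‖v - cU N ψ w x‖ ^ 2 / (2 * (cT N ψ w x + h ^ 2) ^ 2) - 3 / (2 * (cT N ψ w x + h ^ 2))) +
        ⟪v - cU N ψ w x, -(∑ i, Literature.Analysis.FunctionSpaces.Torus.fderiv (ψ N) ((w i).1 - x) (w i).2) • cU N ψ w x +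
          ∑ i, Literature.Analysis.FunctionSpaces.Torus.fderiv (ψ N) ((w i).1 - x) (w i).2 • (w i).2⟫_ℝ / (cT N ψ w x + h ^ 2)))) 0 := by
  have hθ := ((hasDerivAt_cT w x hψs hψ hS).add_const (h ^ 2))
  have hd := hasDerivAt_lM_comp hθ (hasDerivAt_cU w x hψs hψ hS) (by
    simp only [freeFlight_zero]; exact theta_pos w x hψ hh) v
  simp only [freeFlight_zero] at hd
  refine hd.congr_deriv ?_
  rw [inner_smul_right]
  ring

/-- REGULARISED LAW: `∂_r f̂(v) = cW⁻¹ ((1−δ) dK(v) + δ dM(v))` at `r = 0` in a non-empty cell. -/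
theorem hasDerivAt_cellLaw (hψs : Torus.IsSmooth (ψ N)) (hψ : ∀ y, 0 ≤ ψ N y) (hh : 0 < h) (hS : cW N ψ w x ≠ 0)
    (v : V3) :
    HasDerivAt (fun s => cellLaw N ψ h δ (freeFlight (Torus.geometry (Fin 3)) s w) x v)
      ((cW N ψ w x)⁻¹ * ((1 - δ) * (-(∑ i, Literature.Analysis.FunctionSpaces.Torus.fderiv (ψ N) ((w i).1 - x) (w i).2) * kde N ψ h w x v +
          ∑ i, Literature.Analysis.FunctionSpaces.Torus.fderiv (ψ N) ((w i).1 - x) (w i).2 * gauss h (w i).2 v) +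
        δ * (localMaxwellian 1 (cT N ψ w x + h ^ 2) (cU N ψ w x) v *
          ((-(∑ i, Literature.Analysis.FunctionSpaces.Torus.fderiv (ψ N) ((w i).1 - x) (w i).2) * cT N ψ w x +
              ∑ i, Literature.Analysis.FunctionSpaces.Torus.fderiv (ψ N) ((w i).1 - x) (w i).2 * (‖(w i).2 - cU N ψ w x‖ ^ 2 / 3)) *
            (‖v - cU N ψ w x‖ ^ 2 / (2 * (cT N ψ w x + h ^ 2) ^ 2) - 3 / (2 * (cT N ψ w x + h ^ 2))) +
          ⟪v - cU N ψ w x, -(∑ i, Literature.Analysis.FunctionSpaces.Torus.fderiv (ψ N) ((w i).1 - x) (w i).2) • cU N ψ w x +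
            ∑ i, Literature.Analysis.FunctionSpaces.Torus.fderiv (ψ N) ((w i).1 - x) (w i).2 • (w i).2⟫_ℝ / (cT N ψ w x + h ^ 2))))) 0 := by
  have hd := ((hasDerivAt_kde (h := h) w x hψs hS v).const_mul (1 - δ)).fun_add
    ((hasDerivAt_floor w x hψs hψ hh hS v).const_mul δ)
  have e : (fun s => cellLaw N ψ h δ (freeFlight (Torus.geometry (Fin 3)) s w) x v) = fun s => (1 - δ) * kde N ψ h (freeFlight (Torus.geometry (Fin 3)) s w) x v +
      δ * localMaxwellian 1 (cT N ψ (freeFlight (Torus.geometry (Fin 3)) s w) x + h ^ 2) (cU N ψ (freeFlight (Torus.geometry (Fin 3)) s w) x) v := by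
    funext s; rfl
  rw [e]
  refine hd.congr_deriv ?_
  ring

/-- ENTROPY DENSITY: `∂_r (f̂ log f̂)(v) = (1 + log f̂(v)) ∂_r f̂(v)` at `r = 0` in a non-empty cell. -/
theorem hasDerivAt_cellLaw_mul_log (hψ : ∀ y, 0 ≤ ψ N y) (hh : 0 < h) (hδ : 0 < δ) (hδ1 : δ ≤ 1) (v : V3)
    {D : ℝ} (hD : HasDerivAt (fun s => cellLaw N ψ h δ (freeFlight (Torus.geometry (Fin 3)) s w) x v) D 0) :
    HasDerivAt (fun s => cellLaw N ψ h δ (freeFlight (Torus.geometry (Fin 3)) s w) x v * Real.log (cellLaw N ψ h δ (freeFlight (Torus.geometry (Fin 3)) s w) x v))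
      ((1 + Real.log (cellLaw N ψ h δ w x v)) * D) 0 := by
  have h0' : cellLaw N ψ h δ w x v ≠ 0 := (cellLaw_pos w x hψ hh hδ hδ1 v).ne'
  have h0 : cellLaw N ψ h δ (freeFlight (Torus.geometry (Fin 3)) 0 w) x v ≠ 0 := by rwa [freeFlight_zero]
  have hd := hD.fun_mul (hD.log h0)
  refine hd.congr_deriv ?_
  simp only [freeFlight_zero]
  rw [mul_div_cancel₀ D h0']
  ring

end EntropyBudget

/-- Registered anchor of this helper file (`--supports stmt-AtomisticToContinuum-14868`, helper of
`stub_entropyBudget`): the KDE of the cell velocity law is differentiable along a free flight in a non-empty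
cell, with the explicit derivative. -/
theorem bhEntropyBudget_deriv_anchor : ∀ (N : ℕ) (ψ : ℕ → T3 → ℝ) (h : ℝ) (w : Cfg N) (x : T3) (v : V3), Literature.Analysis.FunctionSpaces.Torus.IsSmooth (ψ N) → cW N ψ w x ≠ 0 → HasDerivAt (fun s => kde N ψ h (Literature.Analysis.FluidPDE.freeFlight (Literature.Analysis.FluidPDE.Torus.geometry (Fin 3)) s w) x v) ((cW N ψ w x)⁻¹ * (-(∑ i, Literature.Analysis.FunctionSpaces.Torus.fderiv (ψ N) ((w i).1 - x) (w i).2) * kde N ψ h w x v + ∑ i, Literature.Analysis.FunctionSpaces.Torus.fderiv (ψ N) ((w i).1 - x) (w i).2 * gauss h (w i).2 v)) 0 :=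
  fun _ _ _ w x v hψs hS => EntropyBudget.hasDerivAt_kde w x hψs hS v

end

end Summit.AtomisticToContinuum.HydrodynamicLimit.Theorems.BlockHDissipation
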